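import Literature.NumberTheory.ConnesConsani2021.ArchKernelModesMISound
import Literature.NumberTheory.ConnesConsani2021.ArchKernelL1Assembly
import Literature.NumberTheory.ConnesConsani2021.ArchKernelSonineFrobenius
import Literature.NumberTheory.ConnesConsani2021.EpsSlopeTailFrame
import HarnessLib

/-!
# Connes–Consani 2021 §5–§6, the (E-a) kernel certificate — the eight modes of K1 IDENTIFIED, and the
# SLOPE-FINE enclosure of `ε′(1⁺) = Σ_n t(n)` read back for THE prolate family (input `he` of the Tier-2 entry point)

RH-FREE (label, line 1).  bears_on (cell rh-crit, corpus C1): route «ConnesConsaniSemilocal» item K3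
`WindowSpectralBound` (stmt 19306) — the (E-a) conjunct of `CC2021_section6_enclosures` via t7's entry point
`section6_enclosures_of_tier2 (helo) (he) (het) (hm) (hM) (hcheck)` (`ArchKernelL1Assembly`); this LEAF supplies the
indexed read-back of K1 (`ArchKernelModesMI`, eng-1 g2; soundness `ArchKernelModesMISound`, gm-t16 g2):
* `modes_identified` — there are critical Frobenius parameters `b_j ∈ [χ_j⁻, χ_j⁺]` (the eight thin brackets of
  record) with `u_{b_j}′(0) = 0` and **`prolateFun j = frobEvenExt (b_j)`** for `j < 8`: the certified members ARE the
  even prolate functions `ψ_0, …, ψ_7` in order (t7's `exists_critical_prolateFun_eq_frobEvenExt`: IVT on each bracket,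
  bracket order `χ_j⁺ < χ_{j+1}⁻` and the Wang cap `χ_7⁺ < 272 = 2·8·17` — fed VERBATIM by `modes_lo_le_hi`,
  `modes_endSigns`, `modes_sep`, `modes_top` of the soundness file; NO zero counting);
* `modes_identified_mem`, `mem_epsSlopeTerm_of_lt_eight` — the same in the `MI.mem`/`ht` shapes of eng-1's (B2)
  `ArchKernelTier2CombineSound.combinedLit_encloses`;
* `mem_modeQuantities_of_lt_eight` — hence `λ(j)², ψ_j(1)², λ(j)²ψ_j(1)², t(j) = epsSlopeTerm (prolateFun j)` lie in the
  four quotient intervals of `modeQuantities (modes[j])`;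
* `slopeFine_prolateFun` — the six real inputs of the index-free tail frame for `F = range 8`;
* **`tsum_epsSlopeTerm_prolateFun_mem_fine : eLoNum·2⁻¹²⁸ ≤ Σ' n, epsSlopeTerm (prolateFun n) ≤ eHiNum·2⁻¹²⁸`**
  (width ≈ 5.4·10⁻¹⁸ around `22.99647568387052968`; the (E-b) window of `EpsSlopeEnclosure` was `[22.9, 23.1]`) by
  the same plug as `SlopeCert.tsum_epsSlopeTerm_prolateFun_mem` (gm-t16's frame
  `tsum_epsSlopeTerm_mem_Icc_of_certificate`, Bessel tail `2(1 − S₇)/(1 − Λ)`, `Λ ≤ 3/4`), and the ℚ-shaped corollary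
  `tsum_epsSlopeTerm_prolateFun_mem_of_rat` (= `he` for any rationals `elo ≤ eLoNum/2¹²⁸`, `eHiNum/2¹²⁸ ≤ ehi`; by R121
  take `elo := e_t`).
Source of the numbers: A. Connes, C. Consani, Selecta Math. 27 (2021), Lemma 5.4 §5 pp. 32–33 (`ε′(1⁺) ≃ 22.9965`) and
§6.3–6.4 p. 24 [cite: ConnesConsani2021, Lemma 5.4 §5 pp. 32–33 and §6.3–6.4 p. 24].  Theorems only; nothing here
mentions ζ or RH; nothing here bears on the truth of RH.
-/

noncomputable section

namespace Literature.NumberTheory.ConnesConsani2021.ArchCert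

open Literature.Analysis.ValidatedNumerics.NumericsMP Literature.NumberTheory.LFunctions Finset Real Set
open MeasureTheory intervalIntegral

/-- **The eight modes of record are `ψ_0, …, ψ_7`**: critical parameters in the brackets with
`prolateFun j = frobEvenExt (b j)`. [cite: ConnesConsani2021, Prop. 5.3 / Lemma 5.4 §5 pp. 32–33 and §6.3–6.4 p. 24 (in-kernel certificate for the §6 kernel enclosure); WangLL2010, Lemma 2.2] -/
theorem modes_identified (dflt : ModeData) : ∃ b : ℕ → ℝ, ∀ j < 8,
    b j ∈ Icc (((modes.getD j dflt).chiLo : ℝ) / S) (((modes.getD j dflt).chiHi : ℝ) / S) ∧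
      frobSol₁ 1 (b j) 0 = 0 ∧ prolateFun j = frobEvenExt (b j) :=
  exists_critical_prolateFun_eq_frobEvenExt (modes_lo_le_hi dflt) (modes_endSigns dflt) (modes_sep dflt)
    (modes_top dflt)

/-- **The quotient package of mode `j` encloses the prolate data of index `j`**: `λ(j)² ∈ q.1`, `ψ_j(1)² ∈ q.2.1`,
`λ(j)²ψ_j(1)² ∈ q.2.2.1`, `t(j) = epsSlopeTerm (prolateFun j) ∈ q.2.2.2`. [cite: ConnesConsani2021, Prop. 5.3 / Lemma 5.4 §5 pp. 32–33 and §6.3–6.4 p. 24 (in-kernel certificate for the §6 kernel enclosure)] -/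
theorem mem_modeQuantities_of_lt_eight {dflt : ModeData} {j : ℕ} (hj : j < 8) {q : MI × MI × MI × MI}
    (hq : modeQuantities (modes.getD j dflt) = some q) :
    MI.mem S (prolateEigen j ^ 2) q.1 ∧ MI.mem S (prolateFun j 1 ^ 2) q.2.1 ∧
      MI.mem S (prolateEigen j ^ 2 * prolateFun j 1 ^ 2) q.2.2.1 ∧
      MI.mem S (epsSlopeTerm (prolateFun j)) q.2.2.2 := by
  obtain ⟨b, hb⟩ := modes_identified dflt
  obtain ⟨hbI, hB, hid⟩ := hb j hj
  have hk := ncard_zeros_frobSol_of_prolateFun_eq hB hid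
  obtain ⟨-, hok⟩ := checks_of_mem_modes (getD_mem_modes hj dflt)
  obtain ⟨hT, -, -⟩ := modeTailOK_spec hok
  exact mem_modeQuantities_of_critical hT hq hbI hB hk

/-- `modes_identified` in the `MI.mem` currency of the kernel modules (eng-1's (B2) `combinedLit_encloses (hb) (ht)`,
`md n := modes.getD n dflt`). [cite: ConnesConsani2021, Prop. 5.3 / Lemma 5.4 §5 pp. 32–33 and §6.3–6.4 p. 24 (in-kernel certificate for the §6 kernel enclosure)] -/
theorem modes_identified_mem (dflt : ModeData) : ∃ b : ℕ → ℝ, ∀ j < 8,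
    MI.mem S (b j) (modes.getD j dflt).chi ∧ frobSol₁ 1 (b j) 0 = 0 ∧ prolateFun j = frobEvenExt (b j) := by
  obtain ⟨b, hb⟩ := modes_identified dflt
  refine ⟨b, fun j hj ↦ ?_⟩
  obtain ⟨hbI, hB, hid⟩ := hb j hj
  exact ⟨mem_of_Icc hbI, hB, hid⟩

/-- The `t`-row alone, in the hypothesis shape `ht` of eng-1's (B2) `combinedLit_encloses` / `mem_tI`:
`t(j) = epsSlopeTerm (prolateFun j) ∈ (modeQuantities (modes[j])).2.2.2`. [cite: ConnesConsani2021, Prop. 5.3 / Lemma 5.4 §5 pp. 32–33 and §6.3–6.4 p. 24 (in-kernel certificate for the §6 kernel enclosure)] -/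
theorem mem_epsSlopeTerm_of_lt_eight (dflt : ModeData) : ∀ j < 8, ∀ q : MI × MI × MI × MI,
    modeQuantities (modes.getD j dflt) = some q → MI.mem S (epsSlopeTerm (prolateFun j)) q.2.2.2 :=
  fun _ hj _ hq ↦ (mem_modeQuantities_of_lt_eight hj hq).2.2.2

/-- **The six real inputs of the tail frame, for THE prolate family over `F = range 8`.**
[cite: ConnesConsani2021, Prop. 5.3 / Lemma 5.4 §5 pp. 32–33 and §6.3–6.4 p. 24 (in-kernel certificate for the §6 kernel enclosure)] -/
theorem slopeFine_prolateFun : ∃ Sl Ml : ℝ,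
    Sl ≤ ∑ j ∈ range 8, prolateEigen j ^ 2 * prolateFun j 1 ^ 2 ∧ Ml ≤ ∑ j ∈ range 8, prolateEigen j ^ 2 ∧
      5 / 2 + 478 / 1000 - Ml ≤ 3 / 4 ∧ 0 ≤ 1 - Sl ∧
      (eLoNum : ℝ) / S ≤ ∑ j ∈ range 8, epsSlopeTerm (prolateFun j) ∧
      ∑ j ∈ range 8, epsSlopeTerm (prolateFun j) + 8 * (1 - Sl) ≤ (eHiNum : ℝ) / S := by
  refine slopeFine_real (t := fun j ↦ epsSlopeTerm (prolateFun j))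
    (p := fun j ↦ prolateEigen j ^ 2 * prolateFun j 1 ^ 2) (m := fun j ↦ prolateEigen j ^ 2) ?_
  intro j hj q hq
  have hj8 : j < 8 := by simpa [length_modes] using hj
  have hq' : modeQuantities (modes.getD j ⟨0, 0, 0, false, ⟨0, 0, 0, 0⟩⟩) = some q := by
    rw [List.getD_eq_getElem _ _ hj]; exact hq
  obtain ⟨h1, -, h3, h4⟩ := mem_modeQuantities_of_lt_eight hj8 hq'
  exact ⟨h1, h3, h4⟩

/-- `3/(2π) < 0.478` (from `π > 3.14`). [folklore] -/
private theorem three_div_two_pi_lt : 3 / (2 * π) < 478 / 1000 := by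
  have hπ := Real.pi_gt_d2
  rw [div_lt_iff₀ (by positivity)]
  nlinarith

/-- **SLOPE-FINE for THE prolate family**: `eLoNum·2⁻¹²⁸ ≤ Σ' n, t(n) ≤ eHiNum·2⁻¹²⁸` (width ≈ 5.4·10⁻¹⁸ about
`22.99647568387052968`; printed `ε′(1⁺) ≃ 22.9965`), by the index-free Bessel tail frame over the identified members
`0, …, 7`. [cite: ConnesConsani2021, Lemma 5.4 §5 pp. 32–33 (ε′(1⁺) = Σ λ(n)²(1−λ(n)²)⁻¹ξ_n(1)² ≃ 22.9965) and §6.3–6.4 p. 24] -/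
theorem tsum_epsSlopeTerm_prolateFun_mem_fine :
    (eLoNum : ℝ) / S ≤ ∑' n, epsSlopeTerm (prolateFun n) ∧
      ∑' n, epsSlopeTerm (prolateFun n) ≤ (eHiNum : ℝ) / S := by
  obtain ⟨Sl, Ml, hS, hM, hΛ0, hS1, ha, hB⟩ := slopeFine_prolateFun
  have hΛ : 5 / 2 + 3 / (2 * π) - Ml < 1 := by linarith [three_div_two_pi_lt]
  have hΛ' : 1 / 4 < 1 - (5 / 2 + 3 / (2 * π) - Ml) := by linarith [three_div_two_pi_lt]
  have hBr : ∑ j ∈ range 8, epsSlopeTerm (prolateFun j) +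
      2 * (1 - Sl) / (1 - (5 / 2 + 3 / (2 * π) - Ml)) ≤ (eHiNum : ℝ) / S := by
    have h8 : 2 * (1 - Sl) / (1 - (5 / 2 + 3 / (2 * π) - Ml)) ≤ 2 * (1 - Sl) / (1 / 4) :=
      div_le_div_of_nonneg_left (by positivity) (by norm_num) hΛ'.le
    calc _ ≤ ∑ j ∈ range 8, epsSlopeTerm (prolateFun j) + 2 * (1 - Sl) / (1 / 4) := by linarith
      _ = ∑ j ∈ range 8, epsSlopeTerm (prolateFun j) + 8 * (1 - Sl) := by ring
      _ ≤ _ := hB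
  exact tsum_epsSlopeTerm_mem_Icc_of_certificate (range 8) ha le_rfl hS hM hΛ hBr

/-- **`he` of `section6_enclosures_of_tier2`, ℚ-shaped**: for rationals `elo ≤ eLoNum/2¹²⁸` and `eHiNum/2¹²⁸ ≤ ehi`
(cc-lead R121: take `elo := e_t = 22996475683870528/10¹⁵`), `elo ≤ Σ' n, t(n) ≤ ehi`.
[cite: ConnesConsani2021, Lemma 5.4 §5 pp. 32–33 and §6.3–6.4 p. 24] -/
theorem tsum_epsSlopeTerm_prolateFun_mem_of_rat {elo ehi : ℚ} (hlo : (elo : ℝ) ≤ (eLoNum : ℝ) / S)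
    (hhi : (eHiNum : ℝ) / S ≤ ehi) :
    (elo : ℝ) ≤ ∑' n, epsSlopeTerm (prolateFun n) ∧ ∑' n, epsSlopeTerm (prolateFun n) ≤ (ehi : ℝ) :=
  ⟨hlo.trans tsum_epsSlopeTerm_prolateFun_mem_fine.1, tsum_epsSlopeTerm_prolateFun_mem_fine.2.trans hhi⟩

/-- The concrete instance of record (R121): `e_t = 22996475683870528/10¹⁵ ≤ Σ' t(n) ≤ 22996475683870530/10¹⁵`.
[cite: ConnesConsani2021, Lemma 5.4 §5 pp. 32–33 and §6.3–6.4 p. 24] -/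
theorem tsum_epsSlopeTerm_prolateFun_mem_et :
    ((22996475683870528 / 10 ^ 15 : ℚ) : ℝ) ≤ ∑' n, epsSlopeTerm (prolateFun n) ∧
      ∑' n, epsSlopeTerm (prolateFun n) ≤ ((22996475683870530 / 10 ^ 15 : ℚ) : ℝ) := by
  refine tsum_epsSlopeTerm_prolateFun_mem_of_rat ?_ ?_
  · rw [le_div_iff₀ (by exact_mod_cast S_pos)]
    norm_num [S, eLoNum]
  · rw [div_le_iff₀ (by exact_mod_cast S_pos)]
    norm_num [S, eHiNum]

end Literature.NumberTheory.ConnesConsani2021.ArchCert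

end
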